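import Summits.MatrixMultiplication.OmegaCensus.BoxBadTwoCommutators

/-!
# ω-census, family (b3): conjecture C9 (b) — no finite group whose commutators form a central four-group `{1, c₁, c₂, c₁c₂}` is box-useful

HONEST FRAMING (pub-omega census; verbatim): lottery ticket; floor = certified bounds/negative ranges.
Census BOOKKEEPING (conjecture C9 of the cell, STRUCTURE.md §2; pub-omega kernel-l4 gen 15, task K-4).  Sequel of
`BoxBadTwoCommutators` (`[x,y] = c₁`, `[x,w] = c₂`, `[y,w] = 1` ⇒ not box-useful), making the hypothesis intrinsic: every commutator of
`G` lies in `{1, c₁, c₂, c₁c₂}` for central involutions `c₁ ≠ c₂`, and both `c₁` and `c₂` occur as commutators (`G′ ≅ C₂²` central —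
TYPE II-a of the minimal bad `2`-groups: the nine groups of order `32` with `G′ = C₂²` of class `2`, the nine of order `64`
(`C2CubeExtension`), nine of order `128`, `D₈ × D₈`, …).
* `comm_mul_right'` / `comm_mul_left'`: bilinearity of the commutator when commutators are central;
* **`exists_twoComm`**: some `x` has partners `y, w` with `[x,y] = c₁`, `[x,w] = c₂` AND `y w = w y` (linear algebra of the commutator
  form over `𝔽₂`, done by cases: an element with both values among its commutators exists — else the form would have rank `1` — and
  the pair is then corrected by `x`);
* **`not_boxUseful_of_comm_four`**: such `G` is NOT box-useful; since `|G′| = 4` forces `[G : Z(G)] ≥ 8`, this is exactly C9 (b) on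
  the class.  With `BoxBadDerivedTwo` (`|G′| ≤ 2`): C9 (b) holds for every finite group whose derived group is central of exponent
  `2` and order `≤ 4`.  Classification-free, decide-free.  Nothing here is progress on `ω`.
-/

namespace Summit.MatrixMultiplication.OmegaCensus

open Finset ProductBoxBound

namespace CommPairs

variable {G : Type*} [Group G]

/-- `[x, g h] = [x, g] [x, h]` when `[x, h]` is central. [folklore] -/
theorem comm_mul_right' {x g h : G} (hc : ∀ t : G, t * (x * h * x⁻¹ * h⁻¹) = (x * h * x⁻¹ * h⁻¹) * t) :
    x * (g * h) * x⁻¹ * (g * h)⁻¹ = (x * g * x⁻¹ * g⁻¹) * (x * h * x⁻¹ * h⁻¹) := by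
  calc x * (g * h) * x⁻¹ * (g * h)⁻¹ = (x * g * x⁻¹) * ((x * h * x⁻¹ * h⁻¹) * g⁻¹) := by group
    _ = (x * g * x⁻¹) * (g⁻¹ * (x * h * x⁻¹ * h⁻¹)) := by rw [hc g⁻¹]
    _ = (x * g * x⁻¹ * g⁻¹) * (x * h * x⁻¹ * h⁻¹) := by group

/-- `[g h, x] = [h, x] [g, x]` when `[h, x]` is central. [folklore] -/
theorem comm_mul_left' {x g h : G} (hc : ∀ t : G, t * (h * x * h⁻¹ * x⁻¹) = (h * x * h⁻¹ * x⁻¹) * t) :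
    (g * h) * x * (g * h)⁻¹ * x⁻¹ = (h * x * h⁻¹ * x⁻¹) * (g * x * g⁻¹ * x⁻¹) := by
  calc (g * h) * x * (g * h)⁻¹ * x⁻¹ = g * (h * x * h⁻¹ * x⁻¹) * (x * g⁻¹ * x⁻¹) := by group
    _ = (h * x * h⁻¹ * x⁻¹) * g * (x * g⁻¹ * x⁻¹) := by rw [← hc g]
    _ = (h * x * h⁻¹ * x⁻¹) * (g * x * g⁻¹ * x⁻¹) := by group

/-- `[g, x] = [x, g]⁻¹`. [folklore] -/
theorem comm_swap (x g : G) : g * x * g⁻¹ * x⁻¹ = (x * g * x⁻¹ * g⁻¹)⁻¹ := by group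

section Four

variable {c₁ c₂ : G} (hcomm : ∀ a b : G, a * b * a⁻¹ * b⁻¹ = 1 ∨ a * b * a⁻¹ * b⁻¹ = c₁ ∨ a * b * a⁻¹ * b⁻¹ = c₂ ∨
    a * b * a⁻¹ * b⁻¹ = c₁ * c₂)
  (hz1 : c₁ ∈ Subgroup.center G) (hz2 : c₂ ∈ Subgroup.center G) (h11 : c₁ * c₁ = 1) (h22 : c₂ * c₂ = 1)
include hcomm hz1 hz2 h11 h22

omit h11 h22 in
/-- Every commutator is central. [folklore] -/
theorem comm_central (a b t : G) : t * (a * b * a⁻¹ * b⁻¹) = (a * b * a⁻¹ * b⁻¹) * t := by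
  have e1 : ∀ t : G, t * c₁ = c₁ * t := fun t => Subgroup.mem_center_iff.mp hz1 t
  have e2 : ∀ t : G, t * c₂ = c₂ * t := fun t => Subgroup.mem_center_iff.mp hz2 t
  rcases hcomm a b with h | h | h | h <;> rw [h]
  · rw [mul_one, one_mul]
  · exact e1 t
  · exact e2 t
  · rw [← mul_assoc, e1, mul_assoc, e2, mul_assoc]

/-- From partners `y₀, w₀` with `[x, y₀] = c₁`, `[x, w₀] = c₂` to COMMUTING partners (correct by `x`). [folklore] -/
theorem exists_comm_partners {x y₀ w₀ : G} (hy : x * y₀ * x⁻¹ * y₀⁻¹ = c₁) (hw : x * w₀ * x⁻¹ * w₀⁻¹ = c₂) :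
    ∃ y w : G, x * y * x⁻¹ * y⁻¹ = c₁ ∧ x * w * x⁻¹ * w⁻¹ = c₂ ∧ y * w = w * y := by
  have cen := comm_central hcomm hz1 hz2
  have e21 : c₂ * c₁ = c₁ * c₂ := Subgroup.mem_center_iff.mp hz1 c₂
  have i1 : c₁⁻¹ = c₁ := by rw [inv_eq_iff_mul_eq_one, h11]
  have i2 : c₂⁻¹ = c₂ := by rw [inv_eq_iff_mul_eq_one, h22]
  have hxx : x * x * x⁻¹ * x⁻¹ = 1 := by group
  have hyx : y₀ * x * y₀⁻¹ * x⁻¹ = c₁ := by rw [comm_swap, hy, i1]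
  -- `[x, y₀ x] = c₁`, `[x, w₀ x] = c₂`
  have hy' : x * (y₀ * x) * x⁻¹ * (y₀ * x)⁻¹ = c₁ := by rw [comm_mul_right' (cen x x), hxx, mul_one, hy]
  have hw' : x * (w₀ * x) * x⁻¹ * (w₀ * x)⁻¹ = c₂ := by rw [comm_mul_right' (cen x x), hxx, mul_one, hw]
  have comm_of : ∀ {y w : G}, y * w * y⁻¹ * w⁻¹ = 1 → y * w = w * y := fun {y w} h => by
    calc y * w = y * w * y⁻¹ * w⁻¹ * (w * y) := by group
      _ = w * y := by rw [h, one_mul]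
  rcases hcomm y₀ w₀ with d | d | d | d
  · exact ⟨y₀, w₀, hy, hw, comm_of d⟩
  · -- `[y₀, w₀] = c₁`: take `w = w₀ x`
    refine ⟨y₀, w₀ * x, hy, hw', comm_of ?_⟩
    rw [comm_mul_right' (cen y₀ x), d, hyx, h11]
  · -- `[y₀, w₀] = c₂`: take `y = y₀ x`
    refine ⟨y₀ * x, w₀, hy', hw, comm_of ?_⟩
    rw [comm_mul_left' (cen x w₀), hw, d, h22]
  · -- `[y₀, w₀] = c₁ c₂`: correct both
    refine ⟨y₀ * x, w₀ * x, hy', hw', comm_of ?_⟩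
    rw [comm_mul_left' (cen x (w₀ * x)), hw', comm_mul_right' (cen y₀ x), d, hyx]
    calc c₂ * (c₁ * c₂ * c₁) = c₂ * (c₁ * (c₁ * c₂)) := by rw [mul_assoc, ← e21]
      _ = 1 := by rw [← mul_assoc c₁, h11, one_mul, h22]

/-- **Some element has partners realising both commutator values, commuting with each other** — given that `c₁` and `c₂` both
occur as commutators. [folklore] -/
theorem exists_twoComm (h12 : c₁ ≠ c₂) (h10 : c₁ ≠ 1) (h20 : c₂ ≠ 1) {a b a' b' : G}
    (hab : a * b * a⁻¹ * b⁻¹ = c₁) (hab' : a' * b' * a'⁻¹ * b'⁻¹ = c₂) :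
    ∃ x y w : G, x * y * x⁻¹ * y⁻¹ = c₁ ∧ x * w * x⁻¹ * w⁻¹ = c₂ ∧ y * w = w * y := by
  have cen := comm_central hcomm hz1 hz2
  have e21 : c₂ * c₁ = c₁ * c₂ := Subgroup.mem_center_iff.mp hz1 c₂
  have i1 : c₁⁻¹ = c₁ := by rw [inv_eq_iff_mul_eq_one, h11]
  have i2 : c₂⁻¹ = c₂ := by rw [inv_eq_iff_mul_eq_one, h22]
  have h120 : c₁ * c₂ ≠ 1 := by
    intro e; apply h12
    calc c₁ = c₁ * (c₂ * c₂) := by rw [h22, mul_one]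
      _ = c₂ := by rw [← mul_assoc, e, one_mul]
  have fin := fun {x y₀ w₀ : G} (hy : x * y₀ * x⁻¹ * y₀⁻¹ = c₁) (hw : x * w₀ * x⁻¹ * w₀⁻¹ = c₂) =>
    exists_comm_partners hcomm hz1 hz2 h11 h22 hy hw
  have hba : b * a * b⁻¹ * a⁻¹ = c₁ := by rw [comm_swap, hab, i1]
  have hba' : b' * a' * b'⁻¹ * a'⁻¹ = c₂ := by rw [comm_swap, hab', i2]
  -- case 1: `a` sees `c₂` or `c₁c₂`
  by_cases hA : ∃ g, a * g * a⁻¹ * g⁻¹ = c₂ ∨ a * g * a⁻¹ * g⁻¹ = c₁ * c₂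
  · obtain ⟨g, hg | hg⟩ := hA
    · obtain ⟨y, w, h1, h2, h3⟩ := fin hab hg; exact ⟨a, y, w, h1, h2, h3⟩
    · have : a * (g * b) * a⁻¹ * (g * b)⁻¹ = c₂ := by
        rw [comm_mul_right' (cen a b), hg, hab, mul_assoc, e21, ← mul_assoc, h11, one_mul]
      obtain ⟨y, w, h1, h2, h3⟩ := fin hab this; exact ⟨a, y, w, h1, h2, h3⟩
  by_cases hB : ∃ g, b * g * b⁻¹ * g⁻¹ = c₂ ∨ b * g * b⁻¹ * g⁻¹ = c₁ * c₂
  · obtain ⟨g, hg | hg⟩ := hB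
    · obtain ⟨y, w, h1, h2, h3⟩ := fin hba hg; exact ⟨b, y, w, h1, h2, h3⟩
    · have : b * (g * a) * b⁻¹ * (g * a)⁻¹ = c₂ := by
        rw [comm_mul_right' (cen b a), hg, hba, mul_assoc, e21, ← mul_assoc, h11, one_mul]
      obtain ⟨y, w, h1, h2, h3⟩ := fin hba this; exact ⟨b, y, w, h1, h2, h3⟩
  by_cases hA' : ∃ g, a' * g * a'⁻¹ * g⁻¹ = c₁ ∨ a' * g * a'⁻¹ * g⁻¹ = c₁ * c₂
  · obtain ⟨g, hg | hg⟩ := hA'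
    · obtain ⟨y, w, h1, h2, h3⟩ := fin hg hab'; exact ⟨a', y, w, h1, h2, h3⟩
    · have : a' * (g * b') * a'⁻¹ * (g * b')⁻¹ = c₁ := by
        rw [comm_mul_right' (cen a' b'), hg, hab', mul_assoc, h22, mul_one]
      obtain ⟨y, w, h1, h2, h3⟩ := fin this hab'; exact ⟨a', y, w, h1, h2, h3⟩
  by_cases hB' : ∃ g, b' * g * b'⁻¹ * g⁻¹ = c₁ ∨ b' * g * b'⁻¹ * g⁻¹ = c₁ * c₂
  · obtain ⟨g, hg | hg⟩ := hB'
    · obtain ⟨y, w, h1, h2, h3⟩ := fin hg hba'; exact ⟨b', y, w, h1, h2, h3⟩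
    · have : b' * (g * a') * b'⁻¹ * (g * a')⁻¹ = c₁ := by
        rw [comm_mul_right' (cen b' a'), hg, hba', mul_assoc, h22, mul_one]
      obtain ⟨y, w, h1, h2, h3⟩ := fin this hba'; exact ⟨b', y, w, h1, h2, h3⟩
  -- remaining case: `a, b` only see `{1, c₁}`, `a', b'` only see `{1, c₂}`; then `x = a a'` works with `b, b'`
  push Not at hA hB hA' hB'
  have vA : ∀ g, a * g * a⁻¹ * g⁻¹ = 1 ∨ a * g * a⁻¹ * g⁻¹ = c₁ := fun g => by
    rcases hcomm a g with h | h | h | h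
    · exact Or.inl h
    · exact Or.inr h
    · exact absurd h (hA g).1
    · exact absurd h (hA g).2
  have vB : ∀ g, b * g * b⁻¹ * g⁻¹ = 1 ∨ b * g * b⁻¹ * g⁻¹ = c₁ := fun g => by
    rcases hcomm b g with h | h | h | h
    · exact Or.inl h
    · exact Or.inr h
    · exact absurd h (hB g).1
    · exact absurd h (hB g).2
  have vA' : ∀ g, a' * g * a'⁻¹ * g⁻¹ = 1 ∨ a' * g * a'⁻¹ * g⁻¹ = c₂ := fun g => by
    rcases hcomm a' g with h | h | h | h
    · exact Or.inl h
    · exact absurd h (hA' g).1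
    · exact Or.inr h
    · exact absurd h (hA' g).2
  have vB' : ∀ g, b' * g * b'⁻¹ * g⁻¹ = 1 ∨ b' * g * b'⁻¹ * g⁻¹ = c₂ := fun g => by
    rcases hcomm b' g with h | h | h | h
    · exact Or.inl h
    · exact absurd h (hB' g).1
    · exact Or.inr h
    · exact absurd h (hB' g).2
  -- `[a', b] = 1` and `[a, b'] = 1`
  have hab1 : a' * b * a'⁻¹ * b⁻¹ = 1 := by
    rcases vA' b with h | h
    · exact h
    · exfalso
      rcases vB a' with h' | h'
      · rw [comm_swap, h, i2] at h'; exact h20 h'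
      · rw [comm_swap, h, i2] at h'; exact h12 h'.symm
  have hab2 : a * b' * a⁻¹ * b'⁻¹ = 1 := by
    rcases vA b' with h | h
    · exact h
    · exfalso
      rcases vB' a with h' | h'
      · rw [comm_swap, h, i1] at h'; exact h10 h'
      · rw [comm_swap, h, i1] at h'; exact h12 h'
  have hx1 : (a * a') * b * (a * a')⁻¹ * b⁻¹ = c₁ := by
    rw [comm_mul_left' (cen a' b), hab1, one_mul, hab]
  have hx2 : (a * a') * b' * (a * a')⁻¹ * b'⁻¹ = c₂ := by
    rw [comm_mul_left' (cen a' b'), hab', hab2, mul_one]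
  obtain ⟨y, w, h1, h2, h3⟩ := fin hx1 hx2
  exact ⟨a * a', y, w, h1, h2, h3⟩

/-- **A finite group whose commutators form the central four-group `{1, c₁, c₂, c₁c₂}` (both `c₁, c₂` occurring) is NOT box-useful.**
[folklore] -/
theorem not_boxUseful_of_comm_four [Fintype G] [DecidableEq G] (h12 : c₁ ≠ c₂) (h10 : c₁ ≠ 1) (h20 : c₂ ≠ 1) {a b a' b' : G}
    (hab : a * b * a⁻¹ * b⁻¹ = c₁) (hab' : a' * b' * a'⁻¹ * b'⁻¹ = c₂) : ¬ BoxUseful G := by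
  obtain ⟨x, y, w, h1, h2, h3⟩ := exists_twoComm hcomm hz1 hz2 h11 h22 h12 h10 h20 hab hab'
  exact not_boxUseful_of_twoComm h1 h2 h3 hz1 hz2 h10 h20 h12 h11 h22

end Four

end CommPairs

end Summit.MatrixMultiplication.OmegaCensus
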